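/-
Copyright (c) 2026 the pub-hodgecm-mathlib formalisation cell (harness21).  Prover seat hodgecm-mathlib-F0P3a-p04 (g35): P6b wave B
organ Q9 «KERNEL ON POINTS OF A TORSOR QUOTIENT» (+ the Q1 corollary «subgroup object from the three factorisation clauses») of
CENSUS-Q-junction v1 («LH10» LH10-p01 (g17)); dealer desk F0P6b-plan (g13), box LA-ref2 (g7), 2026-09-03.
-/
import Mathlib.CategoryTheory.Monoidal.Cartesian.Grp
import Mathlib.CategoryTheory.Limits.Shapes.Pullback.IsPullback.Defs
import Mathlib.AlgebraicGeometry.Morphisms.ClosedImmersion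
import Mathlib.CategoryTheory.Comma.Over.Basic
import Literature.AlgebraicGeometry.GroupSchemes.SubgroupSchemeOfSubgroupIdeal
import HarnessLib

/-!
# The kernel of a torsor quotient on `T`-valued points, and subgroup objects from factorisation clauses

Topic `AlgebraicGeometry/GroupSchemes`; namespace `Literature.AlgebraicGeometry.GroupSchemes.TorsorQuotientKernel` (sub-namespace =
the object).  THEOREMS ONLY (no definition, instance, notation or named fact); pure cartesian-monoidal category theory over Mathlib's
group objects (`GrpObj`, `IsMonHom`, the scoped `Hom` groups) and `IsPullback`, instantiated to `Over S` for schemes at the end.  Cell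
`pub/hodgecm-mathlib` (D-0151), organ Q9 (and the Q1 corollary) of the wave-B census `CENSUS-Q-junction.v1` for the socket §Q
`stub_L4B1uQ_quotientByFiniteFlatSubgroup` of `Cruxes/HLiu418/Lines/F0_P6b_MumfordDualFlat.lean` (quotient of an abelian scheme by a finite
flat closed subgroup scheme); lane `--supports stmt-HodgeConjecture-24832`; count-neutral (banked Row-4B capital).  HC_CM is proved only
modulo the printed citations (2 remaining named inputs hLiu418 = `stmt-HodgeConjecture-24832`, h413 = `stmt-HodgeConjecture-24833`) until
rung 0 closes.

THE SETTING ([MumfordAV1970] §12 Thm. 1 p. 111 «(3) `X` is a `G`-torsor over `Y` … `X ×_Y X ≅ G × X`»; [SGA3I] Exp. V Thm. 4.1; [GortzWedhorn2020]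
Def. 4.45 (2) for kernels).  In a cartesian monoidal category `C` (for schemes: `C = Over S`) let `A` be a group object, `i : G ⟶ A` a
homomorphism from a group object `G` (a subgroup when `i` is mono), `act := (i ▷ A) ≫ μ[A] : G ⊗ A ⟶ A` the left translation action, and
`π : A ⟶ Q` a morphism whose KERNEL PAIR IS THE ACTION GROUPOID: the square
```
G ⊗ A --act--> A
  |            |
 snd           π
  v            v
  A  ---π--->  Q
```
is CARTESIAN (`hsq : IsPullback act (snd G A) π π`, i.e. `(act, pr₂) : G ⊗ A ≅ A ×_Q A` — organ Q7 of the census, the output of the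
torsor clause `C ⊗[C₀] C ≅ C ⊗[R] H` of ★ `FiniteFlatQuotientAffine.torsorOverInvariants` globalised).  THEN, on `T`-valued points:
* `comp_eq_comp_iff` — the FIBRES of `π` are the `G`-orbits: `a ≫ π = b ≫ π ↔ ∃ v : T ⟶ G, (v ≫ i) * b = a`;
* `comp_eq_one_comp_iff` — `u ≫ π = 1 ≫ π ↔ ∃ v : T ⟶ G, v ≫ i = u` (no group structure on `Q` needed);
* `comp_eq_one_iff` — when `Q` is a group object and `π` a homomorphism (organ Q8): **`u ≫ π = 1 ↔ ∃ v : T ⟶ G, v ≫ i = u`**, the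
  fifth conjunct of the socket §Q verbatim («the kernel of `π` on `T`-points is exactly `Z`»), with `∃!` when `i` is mono
  (`comp_eq_one_iff_existsUnique`); `hom_comp_eq_one` — `i ≫ π = 1`.
* Q1 corollary `exists_grpObj_isMonHom_of_factors` — the socket's three FACTORISATION CLAUSES for a monomorphism `i : Z ⟶ A`
  (`∃ e, e ≫ i = 1`, `∃ m, m ≫ i = (fst ≫ i) * (snd ≫ i)`, `∃ n, n ≫ i = i⁻¹`) make `Z` a group object with `i` a homomorphism — three
  rewrites into ★ `exists_grpObj_isMonHom_of_lifts` (`GroupSchemes/SubgroupSchemeOfSubgroupIdeal` §1); `isCommMonObj_of_mono` — `Z` is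
  commutative when `A` is.
* Scheme spelling (`C = Over S`): `Over.comp_eq_one_iff_of_isClosedImmersion` etc. — `Mono i` from `IsClosedImmersion i.left` (Mathlib: closed
  immersions are preimmersions, hence monomorphisms; `Over.mono_of_mono_left`).

PROOFS.  Everything is the universal property of the cartesian square read in the group `A(T) = (T ⟶ A)`: a pair `(a, b)` with
`a ≫ π = b ≫ π` is a point `w : T ⟶ G ⊗ A ≅ A ×_Q A` with `w ≫ act = a`, `w ≫ snd = b`, and `w ≫ act = ((w ≫ fst) ≫ i) * (w ≫ snd)`
(`lift_comp_act`); conversely `(lift v b) ≫ act ≫ π = (lift v b) ≫ snd ≫ π = b ≫ π`.  Nothing here uses schemes, flatness or finiteness: those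
enter only in PRODUCING `hsq` (organ Q7).

## References
* [MumfordAV1970] D. Mumford, *Abelian Varieties* (1970), §12 «Quotients by finite group schemes», Thm. 1 (3) p. 111 and its proof p. 114
  («`X` is a `G`-torsor over `Y`»); §7 Thm. 4 (p. 72) («`K = ker f`»).
* [SGA3I] M. Demazure, A. Grothendieck (eds.), *SGA 3, Tome I*, Exp. V (P. Gabriel) Thm. 4.1 (iv); Exp. I 2.3.3 (group functors).
* [GortzWedhorn2020] U. Görtz, T. Wedhorn, *Algebraic Geometry I*, 2nd ed. (2020), Definition 4.45 (2) (p. 117) (kernels), Def. 4.42.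
* [MumfordFogartyKirwan1994] D. Mumford, J. Fogarty, F. Kirwan, *GIT*, 3rd ed. (1994), Ch. 0 §1 (p. 2) (group objects via points).
-/

set_option autoImplicit false

noncomputable section

universe v u

open CategoryTheory CategoryTheory.Limits MonoidalCategory CartesianMonoidalCategory
open scoped MonObj

namespace Literature.AlgebraicGeometry.GroupSchemes.TorsorQuotientKernel

/-! ## §1  The translation action on points -/

section Action

variable {C : Type u} [Category.{v} C] [CartesianMonoidalCategory C] {G A : C} [GrpObj A] (i : G ⟶ A)

/-- **The left translation action on points**: `(v, u) ↦ (v ≫ i) · u`, i.e. `lift v u ≫ (i ▷ A) ≫ μ = (v ≫ i) * u` in the group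
`A(T)`. [cite: MumfordFogartyKirwan1994, Ch. 0 §1 (p. 2)] -/
theorem lift_comp_act {T : C} (v : T ⟶ G) (u : T ⟶ A) :
    lift v u ≫ (i ▷ A) ≫ μ[A] = (v ≫ i) * u := by
  rw [← Category.assoc, lift_whiskerRight, Hom.mul_def]

/-- A point `w` of `G ⊗ A` acts as `w ≫ act = ((w ≫ fst) ≫ i) * (w ≫ snd)`. [cite: MumfordFogartyKirwan1994, Ch. 0 §1 (p. 2)] -/
theorem comp_act_eq_mul {T : C} (w : T ⟶ G ⊗ A) :
    w ≫ (i ▷ A) ≫ μ[A] = ((w ≫ fst G A) ≫ i) * (w ≫ snd G A) := by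
  rw [← lift_comp_fst_snd w, lift_comp_act, lift_fst, lift_snd]

/-- The unit point acts trivially: `lift (𝟙 G) 1 ≫ act = i` (the inclusion `G ≅ G × {e} ⊂ G ⊗ A` followed by the action).
[cite: MumfordFogartyKirwan1994, Ch. 0 §1 (p. 2)] -/
theorem lift_id_one_comp_act :
    lift (𝟙 G) (1 : G ⟶ A) ≫ (i ▷ A) ≫ μ[A] = i := by
  rw [lift_comp_act, Category.id_comp, mul_one]

end Action

/-! ## §2  Fibres and kernel of a torsor quotient on `T`-valued points -/

section Kernel

variable {C : Type u} [Category.{v} C] [CartesianMonoidalCategory C] {G A Q : C} [GrpObj A] (i : G ⟶ A) (π : A ⟶ Q)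

/-- **Translates have the same image**: if the action square commutes (`act ≫ π = snd ≫ π`), then `((v ≫ i) * b) ≫ π = b ≫ π`.
[cite: MumfordAV1970, §12 Thm. 1 (3) (p. 111)] -/
theorem mul_comp_eq_of_w (hw : ((i ▷ A) ≫ μ[A]) ≫ π = snd G A ≫ π) {T : C} (v : T ⟶ G) (b : T ⟶ A) :
    ((v ≫ i) * b) ≫ π = b ≫ π := by
  calc ((v ≫ i) * b) ≫ π = (lift v b ≫ (i ▷ A) ≫ μ[A]) ≫ π := by rw [lift_comp_act]
    _ = lift v b ≫ (((i ▷ A) ≫ μ[A]) ≫ π) := by simp only [Category.assoc]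
    _ = lift v b ≫ (snd G A ≫ π) := by rw [hw]
    _ = b ≫ π := by rw [← Category.assoc, lift_snd]

/-- **The subgroup is killed modulo the unit**: `i ≫ π = 1 ≫ π` as soon as the action square commutes (no group structure on `Q`).
[cite: MumfordAV1970, §12 Thm. 1 (3) (p. 111)] -/
theorem hom_comp_eq_one_comp_of_w (hw : ((i ▷ A) ≫ μ[A]) ≫ π = snd G A ≫ π) :
    i ≫ π = (1 : G ⟶ A) ≫ π := by
  simpa only [Category.id_comp, mul_one] using mul_comp_eq_of_w i π hw (𝟙 G) (1 : G ⟶ A)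

/-- **THE FIBRES OF A TORSOR QUOTIENT ARE THE ORBITS** ([MumfordAV1970] §12 Thm. 1 (3): `X ×_Y X ≅ G × X`, read on `T`-points): if the
action square `act, snd : G ⊗ A ⇉ A → Q` is cartesian, then `a ≫ π = b ≫ π ↔ ∃ v : T ⟶ G, (v ≫ i) * b = a`.
[cite: MumfordAV1970, §12 Thm. 1 (3) (p. 111) and proof (p. 114)] [cite: SGA3I, Exp. V Thm. 4.1 (iv)] -/
theorem comp_eq_comp_iff (hsq : IsPullback ((i ▷ A) ≫ μ[A]) (snd G A) π π) {T : C} (a b : T ⟶ A) :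
    a ≫ π = b ≫ π ↔ ∃ v : T ⟶ G, (v ≫ i) * b = a := by
  constructor
  · intro h
    refine ⟨hsq.lift a b h ≫ fst G A, ?_⟩
    have h1 := comp_act_eq_mul i (hsq.lift a b h)
    rw [hsq.lift_fst, hsq.lift_snd] at h1
    exact h1.symm
  · rintro ⟨v, rfl⟩
    exact mul_comp_eq_of_w i π hsq.w v b

/-- **THE KERNEL ON POINTS, unit-free form**: `u ≫ π = 1 ≫ π ↔ ∃ v : T ⟶ G, v ≫ i = u` (the case `b = 1` of `comp_eq_comp_iff`).
[cite: MumfordAV1970, §12 Thm. 1 (3) (p. 111) and §7 Thm. 4 (p. 72)] -/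
theorem comp_eq_one_comp_iff (hsq : IsPullback ((i ▷ A) ≫ μ[A]) (snd G A) π π) {T : C} (u : T ⟶ A) :
    u ≫ π = (1 : T ⟶ A) ≫ π ↔ ∃ v : T ⟶ G, v ≫ i = u := by
  rw [comp_eq_comp_iff i π hsq]
  simp only [mul_one]

variable [GrpObj Q] [IsMonHom π]

/-- **The subgroup is killed**: `i ≫ π = 1` when `π` is a homomorphism and the action square commutes.
[cite: MumfordAV1970, §7 Thm. 4 (p. 72)] [cite: GortzWedhorn2020, Definition 4.45 (2) (p. 117)] -/
theorem hom_comp_eq_one (hw : ((i ▷ A) ≫ μ[A]) ≫ π = snd G A ≫ π) : i ≫ π = 1 := by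
  rw [hom_comp_eq_one_comp_of_w i π hw, MonObj.one_comp]

/-- **THE KERNEL OF A TORSOR QUOTIENT ON `T`-VALUED POINTS IS THE SUBGROUP** ([MumfordAV1970] §7 Thm. 4 «`K = ker f`», §12 Thm. 1 (3);
[GortzWedhorn2020] Def. 4.45 (2)): for a homomorphism `π : A → Q` of group objects whose action square by the subgroup `i : G → A` is
cartesian, `u ≫ π = 1 ↔ ∃ v : T ⟶ G, v ≫ i = u` for every `u : T ⟶ A` — the kernel clause of the socket §Q
`stub_L4B1uQ_quotientByFiniteFlatSubgroup` verbatim. [cite: MumfordAV1970, §7 Thm. 4 (p. 72) and §12 Thm. 1 (3) (p. 111)]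
[cite: GortzWedhorn2020, Definition 4.45 (2) (p. 117)] -/
theorem comp_eq_one_iff (hsq : IsPullback ((i ▷ A) ≫ μ[A]) (snd G A) π π) {T : C} (u : T ⟶ A) :
    u ≫ π = 1 ↔ ∃ v : T ⟶ G, v ≫ i = u := by
  rw [← comp_eq_one_comp_iff i π hsq u, MonObj.one_comp]

/-- **The kernel on points, with uniqueness** (subgroup case `Mono i`): `u ≫ π = 1 ↔ ∃! v : T ⟶ G, v ≫ i = u`.
[cite: MumfordAV1970, §7 Thm. 4 (p. 72)] [cite: GortzWedhorn2020, Definition 4.45 (2) (p. 117)] -/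
theorem comp_eq_one_iff_existsUnique [Mono i] (hsq : IsPullback ((i ▷ A) ≫ μ[A]) (snd G A) π π) {T : C} (u : T ⟶ A) :
    u ≫ π = 1 ↔ ∃! v : T ⟶ G, v ≫ i = u := by
  rw [comp_eq_one_iff i π hsq]
  constructor
  · rintro ⟨v, hv⟩
    exact ⟨v, hv, fun v' hv' => (cancel_mono i).1 (hv'.trans hv.symm)⟩
  · rintro ⟨v, hv, -⟩
    exact ⟨v, hv⟩

/-- **The fibres of `π` are the orbits, homomorphism form**: `a ≫ π = b ≫ π ↔ ∃ v : T ⟶ G, (v ≫ i) * b = a` — equivalently `a * b⁻¹` lies in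
the kernel; recorded with `comp_eq_one_iff` for consumers that test equality of images. [cite: MumfordAV1970, §12 Thm. 1 (3) (p. 111)] -/
theorem mul_inv_comp_eq_one_iff (hsq : IsPullback ((i ▷ A) ≫ μ[A]) (snd G A) π π) {T : C} (a b : T ⟶ A) :
    (a * b⁻¹) ≫ π = 1 ↔ ∃ v : T ⟶ G, (v ≫ i) * b = a := by
  rw [comp_eq_one_iff i π hsq]
  constructor
  · rintro ⟨v, hv⟩
    exact ⟨v, by rw [hv, inv_mul_cancel_right]⟩
  · rintro ⟨v, rfl⟩
    exact ⟨v, by rw [mul_inv_cancel_right]⟩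

end Kernel

/-! ## §3  Q1: subgroup objects from the three factorisation clauses -/

section Subgroup

variable {C : Type u} [Category.{v} C] [CartesianMonoidalCategory C] {Z A : C} [GrpObj A] (i : Z ⟶ A) [Mono i]

/-- **SUBGROUP OBJECT FROM THE FACTORISATION CLAUSES** ([SGA3I] Exp. I 2.3.3; [GortzWedhorn2020] Def. 4.42): a monomorphism `i : Z ⟶ A` into a
group object through which the unit, the product of the two projections and the inverse FACTOR — the three clauses of the socket §Q
`stub_L4B1uQ_quotientByFiniteFlatSubgroup` verbatim: `∃ e, e ≫ i = 1`, `∃ m, m ≫ i = (fst ≫ i) * (snd ≫ i)`, `∃ n, n ≫ i = i⁻¹` — makes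
`Z` a group object for which `i` is a homomorphism.  Three rewrites (`1 = η`, `(fst ≫ i) * (snd ≫ i) = (i ⊗ i) ≫ μ`, `i⁻¹ = i ≫ ι`) into ★
`exists_grpObj_isMonHom_of_lifts`. [cite: GortzWedhorn2020, Definition 4.42 and (4.15), pp. 116–117] [cite: MumfordFogartyKirwan1994, Ch. 0 §1 (p. 2)] -/
theorem exists_grpObj_isMonHom_of_factors
    (he : ∃ e : 𝟙_ C ⟶ Z, e ≫ i = 1)
    (hm : ∃ m : Z ⊗ Z ⟶ Z, m ≫ i = (fst Z Z ≫ i) * (snd Z Z ≫ i))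
    (hn : ∃ n : Z ⟶ Z, n ≫ i = i⁻¹) :
    ∃ GZ : GrpObj Z, letI := GZ; IsMonHom i := by
  obtain ⟨e, he⟩ := he
  obtain ⟨m, hm⟩ := hm
  obtain ⟨n, hn⟩ := hn
  have he' : e ≫ i = η[A] := by rw [he, MonObj.one_eq_one]
  have hm' : m ≫ i = (i ⊗ₘ i) ≫ μ[A] := by rw [hm, Hom.mul_def, lift_fst_comp_snd_comp]
  have hn' : n ≫ i = i ≫ ι[A] := by rw [hn, Hom.inv_def]
  obtain ⟨GZ, -, -, -, hhom⟩ := exists_grpObj_isMonHom_of_lifts i m hm' e he' n hn'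
  exact ⟨GZ, hhom⟩

/-- **With the structure morphisms named**: the group structure of `exists_grpObj_isMonHom_of_factors` has `μ = m`, `η = e`, `ι = n` for the
given factorisations (they are unique, `i` being mono). [cite: GortzWedhorn2020, Definition 4.42 and (4.15), pp. 116–117] -/
theorem exists_grpObj_isMonHom_of_factors'
    (e : 𝟙_ C ⟶ Z) (he : e ≫ i = 1) (m : Z ⊗ Z ⟶ Z) (hm : m ≫ i = (fst Z Z ≫ i) * (snd Z Z ≫ i))
    (n : Z ⟶ Z) (hn : n ≫ i = i⁻¹) :
    ∃ GZ : GrpObj Z, @MonObj.mul C _ _ Z GZ.toMonObj = m ∧ @MonObj.one C _ _ Z GZ.toMonObj = e ∧ @GrpObj.inv C _ _ Z GZ = n ∧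
      (letI := GZ; IsMonHom i) := by
  have he' : e ≫ i = η[A] := by rw [he, MonObj.one_eq_one]
  have hm' : m ≫ i = (i ⊗ₘ i) ≫ μ[A] := by rw [hm, Hom.mul_def, lift_fst_comp_snd_comp]
  have hn' : n ≫ i = i ≫ ι[A] := by rw [hn, Hom.inv_def]
  exact exists_grpObj_isMonHom_of_lifts i m hm' e he' n hn'

omit [Mono i] in
/-- **Any subgroup structure has the expected points**: if `Z` is a group object and `i` a homomorphism, the unit, product and inverse
of `A(T)` preserve `{u | ∃ v, v ≫ i = u}` — the converse bookkeeping used by the torsor-kernel consumers. [cite: MumfordFogartyKirwan1994, Ch. 0 §1 (p. 2)] -/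
theorem exists_comp_eq_mul [GrpObj Z] [IsMonHom i] {T : C} (v₁ v₂ : T ⟶ Z) :
    ∃ v : T ⟶ Z, v ≫ i = (v₁ ≫ i) * (v₂ ≫ i) :=
  ⟨v₁ * v₂, MonObj.mul_comp v₁ v₂ i⟩

omit [Mono i] in
/-- The inverse of a point of the subgroup is a point of the subgroup. [cite: MumfordFogartyKirwan1994, Ch. 0 §1 (p. 2)] -/
theorem exists_comp_eq_inv [GrpObj Z] [IsMonHom i] {T : C} (v : T ⟶ Z) :
    ∃ v' : T ⟶ Z, v' ≫ i = (v ≫ i)⁻¹ :=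
  ⟨v⁻¹, GrpObj.inv_comp v i⟩

omit [Mono i] in
/-- The unit is a point of the subgroup. [cite: MumfordFogartyKirwan1994, Ch. 0 §1 (p. 2)] -/
theorem exists_comp_eq_one [GrpObj Z] [IsMonHom i] (T : C) :
    ∃ v : T ⟶ Z, v ≫ i = (1 : T ⟶ A) :=
  ⟨1, MonObj.one_comp i⟩

/-- **A subgroup of a commutative group object is commutative**: if `A` is commutative, `Z` a group object and the monomorphism `i` a
homomorphism, then `Z` is commutative (`μ ∘ β = μ` tested after `i` in the commutative group `A(Z ⊗ Z)`).
[cite: MumfordFogartyKirwan1994, Ch. 0 §1 (p. 2)] -/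
theorem isCommMonObj_of_mono [BraidedCategory C] [IsCommMonObj A] [GrpObj Z] [IsMonHom i] : IsCommMonObj Z where
  mul_comm := by
    rw [← cancel_mono i, Category.assoc, IsMonHom.mul_hom i, ← lift_fst_comp_snd_comp, ← Hom.mul_def, MonObj.comp_mul]
    simp only [← Category.assoc, braiding_hom_fst, braiding_hom_snd]
    exact mul_comm _ _

/-- **The socket's shape, commutative case**: the three factorisation clauses for a monomorphism into a COMMUTATIVE group object give a
commutative group object `Z` with `i` a homomorphism. [cite: GortzWedhorn2020, Definition 4.42 and (4.15), pp. 116–117] -/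
theorem exists_grpObj_isMonHom_isCommMonObj_of_factors [BraidedCategory C] [IsCommMonObj A]
    (he : ∃ e : 𝟙_ C ⟶ Z, e ≫ i = 1)
    (hm : ∃ m : Z ⊗ Z ⟶ Z, m ≫ i = (fst Z Z ≫ i) * (snd Z Z ≫ i))
    (hn : ∃ n : Z ⟶ Z, n ≫ i = i⁻¹) :
    ∃ GZ : GrpObj Z, letI := GZ; IsMonHom i ∧ IsCommMonObj Z := by
  obtain ⟨GZ, hhom⟩ := exists_grpObj_isMonHom_of_factors i he hm hn
  letI := GZ
  haveI := hhom
  exact ⟨GZ, hhom, isCommMonObj_of_mono i⟩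

end Subgroup

/-! ## §4  Scheme spelling: `C = Over S`, `Mono i` from a closed immersion -/

section Scheme

open _root_.AlgebraicGeometry

variable {S : Scheme.{u}} {Z A Q : Over S} [GrpObj A] (i : Z ⟶ A) (π : A ⟶ Q)

omit [GrpObj A] in
/-- A morphism of `S`-schemes whose underlying morphism is a closed immersion is a monomorphism of `Over S` (Mathlib: closed immersions are
preimmersions, hence monomorphisms; `Over.mono_of_mono_left`). [cite: GortzWedhorn2020, Definition 4.42 and (4.15), pp. 116–117] -/
theorem Over.mono_of_isClosedImmersion_left [IsClosedImmersion i.left] : Mono i :=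
  Over.mono_of_mono_left i

/-- **Q1 for schemes**: a closed immersion `i : Z ↪ A` of `S`-schemes into an `S`-group scheme through which the unit, the product of the two
projections and the inverse factor (the hypotheses of the socket §Q verbatim) is a closed SUBGROUP scheme: `Z` carries a group-scheme
structure over `S` with `i` a homomorphism. [cite: GortzWedhorn2020, Definition 4.42 and (4.15), pp. 116–117] -/
theorem Over.exists_grpObj_isMonHom_of_factors [IsClosedImmersion i.left]
    (he : ∃ e : 𝟙_ (Over S) ⟶ Z, e ≫ i = 1)
    (hm : ∃ m : Z ⊗ Z ⟶ Z, m ≫ i = (fst Z Z ≫ i) * (snd Z Z ≫ i))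
    (hn : ∃ n : Z ⟶ Z, n ≫ i = i⁻¹) :
    ∃ GZ : GrpObj Z, letI := GZ; IsMonHom i :=
  haveI := Over.mono_of_isClosedImmersion_left i
  TorsorQuotientKernel.exists_grpObj_isMonHom_of_factors i he hm hn

/-- **Q9 for schemes** ([MumfordAV1970] §7 Thm. 4, §12 Thm. 1 (3)): for a homomorphism `π : A → Q` of `S`-group schemes whose action square
`act, pr₂ : Z ×_S A ⇉ A → Q` by the closed subgroup scheme `i : Z ↪ A` is cartesian in `Over S`, the kernel of `π` on `T`-valued points is
exactly `Z`: `u ≫ π = 1 ↔ ∃ v : T ⟶ Z, v ≫ i = u` — the fifth conjunct of the socket §Q. [cite: MumfordAV1970, §7 Thm. 4 (p. 72) and §12 Thm. 1 (3) (p. 111)]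
[cite: GortzWedhorn2020, Definition 4.45 (2) (p. 117)] -/
theorem Over.comp_eq_one_iff [GrpObj Z] [GrpObj Q] [IsMonHom π]
    (hsq : IsPullback ((i ▷ A) ≫ μ[A]) (snd Z A) π π) (T : Over S) (u : T ⟶ A) :
    u ≫ π = 1 ↔ ∃ v : T ⟶ Z, v ≫ i = u :=
  TorsorQuotientKernel.comp_eq_one_iff i π hsq u

end Scheme

end Literature.AlgebraicGeometry.GroupSchemes.TorsorQuotientKernel

end
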